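import Literature.AlgebraicGeometry.Motives.HodgeLieWeightOnePlusLineIdeal
import Literature.AlgebraicGeometry.Motives.SpanCInvariantForms
import Literature.AlgebraicGeometry.Motives.HodgeLieReductiveAnyWeight
import HarnessLib

/-!
# Weight one, type-III position: the trace form of `V_ℂ` is non-degenerate on `𝔥_ℂ` and on the compact factor `𝔨`

Family `hodge`, layer `Literature/AlgebraicGeometry/Motives`; THEOREMS ONLY (no definition, no named fact; D-0026).
Sequel of `HodgeLieWeightOnePlusLineIdeal` for the cell `pub-hodgecm2` (COR-CM) lane MT-RANK-SEVEN-TYPEIII, seat `b27`.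

SETTING (the type-III position): `H` polarizable of weight `1` on `V`, graded basis `e`, Hodge projector `P`, plus-line
hypotheses (`E F = αP`, `F E = α(1 − P)`), `𝔷 = Lie Hg ∩ End_Hdg = 0`;
`𝔥_ℂ = 𝔰 ⊕ 𝔨`, `𝔰 = ⟨E, F, Θ⟩`, `𝔨 = {K ∈ 𝔥_ℂ : KP = PK, KE = EK}`.

THE TRACE FORM `τ(x, y) = tr_{V_ℂ}(x y)`.  Its restriction to the rational Lie algebra `𝔥` is non-degenerate for every
polarizable `H` (`AnyWeight.hodgeLie_trace_separating`, Deligne's positivity `tr(X X^*) > 0`), hence `τ` is non-degenerate on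
`𝔥_ℂ` (descent of degeneracy, `exists_ne_zero_orthogonal_of_spanC`: a Gram determinant is rational); and since `𝔰 ⊥ 𝔨` for
`τ` (trace table: `tr(E K) = tr(F K) = tr(Θ K) = 0`) and `𝔥_ℂ = 𝔰 + 𝔨`, it is non-degenerate on `𝔨` as well.  This is the
input for the `sl₂`-triple spanning `𝔨` (sequel `HodgeLieWeightOnePlusLineSl2Triple`).

* **`eq_zero_of_mem_hodgeLieC_of_forall_trace_mul_eq_zero`** — (any weight) `x ∈ 𝔥_ℂ` with `tr(y x) = 0` for all
  `y ∈ 𝔥_ℂ` ⟹ `x = 0`.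
* **`eq_zero_of_forall_trace_mul_eq_zero_centraliser`** — `K ∈ 𝔨` with `tr(K' K) = 0` for all `K' ∈ 𝔨` ⟹ `K = 0`.

## References

* [MoonenZarhin1999LowDim] B. Moonen, Yu. Zarhin, *Hodge classes on abelian varieties of low dimension*, Math. Ann. 315
  (1999), §2 (2.3) Type III.
* [Deligne1982HodgeCycles] P. Deligne, *Hodge cycles on abelian varieties*, LNM 900 (1982), I §3 (3.4–3.6).
* [Humphreys1972] J. E. Humphreys, GTM 9 (1972), §5.1.
-/

noncomputable section

open scoped TensorProduct

namespace Literature.AlgebraicGeometry.Motives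

universe u

namespace HodgeStructure

open ProjectorBlocks Literature.RepresentationTheory.GeneralLinear

variable {V : Type u} [AddCommGroup V] [Module ℚ V] [Module.Finite ℚ V] [HodgeTensorFacts.{u, u}] {n : ℤ}
  {S : Type u} [Fintype S] [DecidableEq S] {deg : S → ℤ}

/-! ## §1 Non-degeneracy of `tr_{V_ℂ}(x y)` on `𝔥_ℂ` (any weight) -/

/-- **The trace form `tr_{V_ℂ}(y x)` is non-degenerate on `𝔥_ℂ = Lie Hg ⊗ ℂ`** for every polarizable Hodge structure
(any weight): the rational trace form `tr_V(XY)` is non-degenerate on `Lie Hg` (`AnyWeight.hodgeLie_trace_separating`,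
Deligne's positivity argument), and degeneracy descends from `ℂ` to `ℚ` (`exists_ne_zero_orthogonal_of_spanC`: the Gram
determinant is rational). [cite: Deligne1982HodgeCycles, I §3 (3.4–3.6)] [cite: Humphreys1972, §5.1] -/
theorem eq_zero_of_mem_hodgeLieC_of_forall_trace_mul_eq_zero (H : HodgeStructure V n) (ψ : H.Polarization)
    {x : Module.End ℂ (ℂ ⊗[ℚ] V)} (hx : x ∈ H.hodgeLieC)
    (hrad : ∀ y ∈ H.hodgeLieC, LinearMap.trace ℂ (ℂ ⊗[ℚ] V) (y * x) = 0) : x = 0 := by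
  letI : LieRing (Module.End ℚ V) := LieRing.ofAssociativeRing
  classical
  -- the rational Lie algebra and its trace form `τ(X, Y) = tr_V(X Y)`
  obtain ⟨𝔏, h𝔏⟩ : ∃ 𝔏 : LieSubalgebra ℚ (Module.End ℚ V), 𝔏.toSubmodule = H.hodgeLie :=
    ⟨{ H.hodgeLie with
        lie_mem' := fun {a b} ha hb => by
          rw [LieRing.of_associative_ring_bracket]
          exact H.commutator_mem_hodgeLie ha hb }, rfl⟩
  have h𝔤' : H.hodgeLieC = spanC 𝔏.toSubmodule := by rw [h𝔏, hodgeLieC_eq_spanC]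
  obtain ⟨τ, hτ⟩ : ∃ τ : LinearMap.BilinForm ℚ 𝔏, τ = LieModule.traceForm ℚ 𝔏 V := ⟨_, rfl⟩
  have hτapply : ∀ X₁ Y₁ : 𝔏, τ X₁ Y₁ = LinearMap.trace ℚ V ((X₁ : Module.End ℚ V) * Y₁) := by
    intro X₁ Y₁
    rw [hτ, LieModule.traceForm_apply_apply]
    rfl
  -- the complex trace form on `𝔥_ℂ` and its compatibility with `τ`
  obtain ⟨τ', hτ'⟩ : ∃ τ' : H.hodgeLieC → H.hodgeLieC → ℂ, ∀ x y, τ' x y =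
      LinearMap.trace ℂ (ℂ ⊗[ℚ] V) ((x : Module.End ℂ (ℂ ⊗[ℚ] V)) * y) := ⟨_, fun _ _ => rfl⟩
  have hadd : ∀ y x x' : H.hodgeLieC, τ' y (x + x') = τ' y x + τ' y x' := by
    intro y x x'; rw [hτ', hτ', hτ', Submodule.coe_add, mul_add, map_add]
  have hsmul : ∀ (c : ℂ) (y x : H.hodgeLieC), τ' y (c • x) = c * τ' y x := by
    intro c y x; rw [hτ', hτ', Submodule.coe_smul, mul_smul_comm, map_smul, smul_eq_mul]
  have hcompat : ∀ (X₁ Y₁ : 𝔏.toSubmodule) (hX₁ : (X₁ : Module.End ℚ V).baseChange ℂ ∈ H.hodgeLieC)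
      (hY₁ : (Y₁ : Module.End ℚ V).baseChange ℂ ∈ H.hodgeLieC), τ' ⟨_, hX₁⟩ ⟨_, hY₁⟩ = algebraMap ℚ ℂ (τ X₁ Y₁) := by
    intro X₁ Y₁ hX₁ hY₁
    rw [hτ', hτapply]
    change LinearMap.trace ℂ (ℂ ⊗[ℚ] V) ((X₁ : Module.End ℚ V).baseChange ℂ * (Y₁ : Module.End ℚ V).baseChange ℂ) = _
    rw [← LinearMap.baseChange_mul, LinearMap.trace_baseChange]
  -- descent of degeneracy, and non-degeneracy over `ℚ`
  by_contra hx0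
  obtain ⟨x₁, hx₁0, hx₁rad⟩ := exists_ne_zero_orthogonal_of_spanC 𝔏.toSubmodule H.hodgeLieC h𝔤' τ τ' hadd hsmul
    hcompat (x' := ⟨x, hx⟩) (fun h => hx0 (congrArg Subtype.val h)) (fun y' => by rw [hτ']; exact hrad y'.1 y'.2)
  have hx₁M : (x₁ : Module.End ℚ V) ∈ H.hodgeLie := by rw [← h𝔏]; exact x₁.2
  refine hx₁0 (Subtype.ext ?_)
  refine AnyWeight.hodgeLie_trace_separating H ψ hx₁M fun Y hY => ?_
  have h := hx₁rad ⟨Y, by rw [h𝔏]; exact hY⟩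
  rw [hτapply, LinearMap.trace_mul_comm] at h
  exact h

/-! ## §2 Non-degeneracy on the compact factor `𝔨` -/

/-- **The trace form `tr_{V_ℂ}(K' K)` is non-degenerate on `𝔨 = {K ∈ 𝔥_ℂ : KP = PK, KE = EK}`**: `𝔰 = ⟨E, F, Θ⟩` is
`tr`-orthogonal to `𝔨` (`tr(E K) = tr(F K) = tr(Θ K) = 0`, the trace table) and `𝔥_ℂ = 𝔰 + 𝔨`, so a vector of `𝔨`
orthogonal to `𝔨` is orthogonal to `𝔥_ℂ`. [cite: MoonenZarhin1999LowDim, §2 (2.3)]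
[cite: Deligne1982HodgeCycles, I §3 (3.4–3.6)] -/
theorem eq_zero_of_forall_trace_mul_eq_zero_centraliser (H : HodgeStructure V n) (ψ : H.Polarization) (hn : n = 1)
    (e : Module.Basis S ℂ (ℂ ⊗[ℚ] V)) (hF : ∀ a, H.F a = Submodule.span ℂ (e '' {σ | a ≤ deg σ}))
    (hFc : ∀ a, complexConj (H.F a) = Submodule.span ℂ (e '' {σ | deg σ ≤ n - a}))
    (hdeg : ∀ σ, deg σ = 0 ∨ deg σ = 1) {X : Module.End ℚ V} (hX : X ∈ H.hodgeLie) (hXE : X ∉ H.endAlg)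
    (hplus : ∀ Y ∈ H.hodgeLieC, ∃ c : ℂ,
      gradingEnd e deg * Y * (1 - gradingEnd e deg) = c • (gradingEnd e deg * X.baseChange ℂ * (1 - gradingEnd e deg)))
    (hminus : ∀ Y ∈ H.hodgeLieC, ∃ c : ℂ,
      (1 - gradingEnd e deg) * Y * gradingEnd e deg = c • ((1 - gradingEnd e deg) * X.baseChange ℂ * gradingEnd e deg))
    (hz : H.hodgeLie ⊓ Subalgebra.toSubmodule H.endAlg = ⊥)
    {K : Module.End ℂ (ℂ ⊗[ℚ] V)} (hK : K ∈ H.hodgeLieC) (hKP : K * gradingEnd e deg = gradingEnd e deg * K)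
    (hKE : K * (gradingEnd e deg * X.baseChange ℂ * (1 - gradingEnd e deg)) =
      (gradingEnd e deg * X.baseChange ℂ * (1 - gradingEnd e deg)) * K)
    (hrad : ∀ K' ∈ H.hodgeLieC, K' * gradingEnd e deg = gradingEnd e deg * K' →
      K' * (gradingEnd e deg * X.baseChange ℂ * (1 - gradingEnd e deg)) =
        (gradingEnd e deg * X.baseChange ℂ * (1 - gradingEnd e deg)) * K' →
      LinearMap.trace ℂ (ℂ ⊗[ℚ] V) (K' * K) = 0) : K = 0 := by
  classical
  obtain ⟨α, hα, hEF, hFE, -⟩ :=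
    projE_mul_projF_eq_smul_of_plusLine_of_center_eq_bot H ψ hn e hF hFc hdeg hX hXE hplus hminus hz
  have hPP : gradingEnd e deg * gradingEnd e deg = gradingEnd e deg := gradingEnd_mul_gradingEnd_of_deg e hdeg
  refine eq_zero_of_mem_hodgeLieC_of_forall_trace_mul_eq_zero H ψ hK fun y hy => ?_
  obtain ⟨c, c', d, Z, hZM, hZP, hZE, hYdec⟩ := exists_decomposition_of_plusLine H hn e hF hFc hdeg hX hplus hminus hy
  set P := gradingEnd e deg with hP
  set E := P * X.baseChange ℂ * (1 - P) with hEdef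
  set F := (1 - P) * X.baseChange ℂ * P with hFdef
  have hPE : P * E = E := by rw [hEdef, ← mul_assoc, ← mul_assoc, hPP]
  have hEP : E * P = 0 := by
    rw [hEdef, mul_assoc (P * X.baseChange ℂ) (1 - P) P, sub_mul, one_mul, hPP, sub_self, mul_zero]
  have hPF : P * F = 0 := by
    rw [hFdef, mul_assoc (1 - P) (X.baseChange ℂ) P, ← mul_assoc P (1 - P), mul_sub, mul_one, hPP, sub_self, zero_mul]
  have hFP : F * P = F := by rw [hFdef, mul_assoc ((1 - P) * X.baseChange ℂ) P P, hPP]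
  clear_value P E F
  -- the trace table against `K`
  have htrE : LinearMap.trace ℂ (ℂ ⊗[ℚ] V) (E * K) = 0 := by
    have h := trace_mul_projE_mul_eq_zero (z := 1) (Z := K) hPP hPE hEP (by rw [one_mul, mul_one]) hKP
    rw [one_mul] at h
    exact h
  have htrF : LinearMap.trace ℂ (ℂ ⊗[ℚ] V) (F * K) = 0 := by
    have h := trace_mul_projF_mul_eq_zero (z := 1) (Z := K) hPP hPF hFP (by rw [one_mul, mul_one]) hKP
    rw [one_mul] at h
    exact h
  have htrΘ : LinearMap.trace ℂ (ℂ ⊗[ℚ] V) (((2 : ℂ) • P - 1) * K) = 0 := by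
    have h := trace_mul_theta_mul_eq_zero (z := 1) (Z := K) hα hEF hFE (by rw [one_mul, mul_one]) hKE
    rw [one_mul] at h
    exact h
  rw [hYdec, add_mul, add_mul, add_mul, smul_mul_assoc, smul_mul_assoc, smul_mul_assoc, map_add, map_add, map_add,
    map_smul, map_smul, map_smul, htrE, htrF, htrΘ, hrad Z hZM hZP hZE, smul_zero, smul_zero, smul_zero, add_zero, add_zero,
    add_zero]

end HodgeStructure

end Literature.AlgebraicGeometry.Motives

end
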